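import Literature.Computability.Complexity.PromiseZPP
import Literature.Computability.MetaComplexity.GapMINKT
import HarnessLib

/-!
# Complexity meta: the average-case side of Hirahara's reduction for `Gap MINKT`

Topic `Literature/Computability/MetaComplexity`, companion to `GapMINKT.lean` (`U.gapMINKT σ τ`, the
named fact `Hirahara2018_gapMINKT_mem_PromiseP` = Hirahara 2018, Cor. 4.23) and to
`AvgCaseDerandomization.lean` (Buhrman–Fortnow–Pavan). This file vendors the *randomised*
statement from which Cor. 4.23 is derived in print:

* `Hirahara2018_gapMINKT_mem_PromiseZPP` — **Cor. 4.22, (1 ⇒ 4)**: *if `DistNP ⊆ AvgP` then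
  `Gap_{σ,τ}MINKT ∈ Promise-ZPP` for some `σ(n,s) = s + O((log n)√s + (log n)²)` and some
  polynomial `τ(n,t)`* (ECCC TR18-138 rev. 1, Cor. 4.22: "1 ⇒ 2 ⇒ 3 ⇒ 4" with 1 = `DistNP ⊆ AvgP`,
  2 = `(MINKT[r], 𝒟^KT) ∈ Avg_{1/6m}P`, 3 = a zero-error randomised polynomial-time algorithm for
  the search version (Thm. 4.21), 4 = `Gap_{σ,τ}MINKT ∈ Promise-ZPP` (Fact 3.8); FOCS version
  Cor. I.2).

`Promise-ZPP` is the textbook class `PromiseZPP' = PromiseRP' ∩ PromiseCoRP'` of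
`Literature/Computability/Complexity/PromiseZPP.lean` (Hirahara, §3: "for a complexity class C such as ZPP and BPP,
we denote by Promise-C the promise version of C"). The parameters are rendered exactly as in
`Hirahara2018_gapMINKT_mem_PromiseP` (explicit `O`-constant `c`, `Nat.log 2`, `Nat.sqrt`, a bounding
`Polynomial ℕ` in `n + t`, Def. 3.6's standing side conditions `s ≤ σ(n,s)`, `t ≤ τ(n,t)`), so that
the printed derivation of Cor. 4.23 — Cor. 4.22 plus `Promise-BPP = Promise-P` under `DistNP ⊆ AvgP`
(Buhrman–Fortnow–Pavan) — is the ten-line assembly `Hirahara2018_gapMINKT_mem_PromiseP_of` of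
`GapMINKTProofs.lean` (with `PromiseZPP' ⊆ PromiseBPP'`, `PromiseZPPProofs.lean`).

Deliberately NOT here (next layer of the decomposition, see `GapMINKTProofs.lean`): the search
version (Def. 3.7) and Thm. 4.21 itself, `MINKT[r]`/`𝒟^KT` (Defs. 4.13–4.14), dense subsets of
`r`-random strings (Defs. 4.1–4.2, Lemma 4.17), the Nisan–Wigderson reconstruction with
list-decodable codes (Lemma 4.6 – Cor. 4.12).

## References

* S. Hirahara, *Non-black-box worst-case to average-case reductions within NP*, FOCS 2018,
  247–258 (Thm. I.1, Cor. I.2); full version ECCC TR18-138 rev. 1 (2019): Def. 3.6, Fact 3.8,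
  Thm. 4.21, Cor. 4.22, Cor. 4.23 [Hirahara2018] (text checked: ECCC revision 1 PDF).
* J. Gill, *Computational complexity of probabilistic Turing machines*, SIAM J. Comput. 6 (1977)
  (`ZPP = RP ∩ coRP`).
-/

namespace Literature.Computability.MetaComplexity

open _root_.Computability Complexity

/-- **Hirahara 2018, Corollary 4.22 (1 ⇒ 4)** (non-black-box worst-case-to-average-case reduction
for `MINKT`, randomised form). *If `DistNP ⊆ AvgP` then `Gap_{σ,τ}MINKT ∈ Promise-ZPP` for some
`σ(n, s) = s + O((log n)·√s + (log n)²)` and some polynomial `τ(n, t)`.*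

Conventions exactly as in `Hirahara2018_gapMINKT_mem_PromiseP` (`GapMINKT.lean`): the efficient
universal machine is universally quantified; "`σ(n,s) = s + O((log n)√s + (log n)²)`" is the explicit
upper bound `σ n s ≤ s + c·(log₂ n·⌊√s⌋ + (log₂ n)² + 1)`, "polynomial `τ`" is `τ n t ≤ p.eval (n + t)`,
together with Def. 3.6's side conditions `s ≤ σ(n,s)`, `t ≤ τ(n,t)`; `Promise-ZPP` is the textbook
class `PromiseZPP'` (`PromiseZPP.lean`). In print this is the chain 1 ⇒ 2 (`(MINKT[n-1], 𝒟^KT) ∈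
DistNP ⊆ AvgP ⊆ Avg_{1/6m}P`) ⇒ 3 (Thm. 4.21, zero-error search algorithm) ⇒ 4 (Fact 3.8).
[cite: Hirahara2018, Cor. 4.22] -/
def Hirahara2018_gapMINKT_mem_PromiseZPP : Prop :=
  ∀ U : UniversalMachine, DistNP ⊆ AvgP →
    ∃ (σ τ : ℕ → ℕ → ℕ) (c : ℕ) (p : Polynomial ℕ),
      (∀ n s, s ≤ σ n s ∧ σ n s ≤ s + c * (Nat.log 2 n * Nat.sqrt s + Nat.log 2 n ^ 2 + 1)) ∧
      (∀ n t, t ≤ τ n t ∧ τ n t ≤ p.eval (n + t)) ∧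
      U.gapMINKT σ τ ∈ PromiseZPP'

end Literature.Computability.MetaComplexity
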